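import Literature.Probability.Percolation.TwoArmScalingLimitFromLoops
import Literature.Probability.RandomPlanarGeometry.LoopSpaceRangeEvents
import Literature.Probability.Percolation.AltFourArmOfCrossingLoops
import HarnessLib

/-!
# The alternating four-arm probabilities are bounded below by the loop scaling limit

Topic: Probability / Percolation. Proof file (one definition: the shell-traversal event of a loop
collection) serving the named fact `Literature.Probability.Percolation.fourArm_exponent`
(S. Smirnov, W. Werner, Math. Res. Lett. **8** (2001), Thm. 4 of arXiv `math/0109120`, `j = 4`)
through its continuum input (16)₄, the scaling limit of the ALTERNATING four-arm probabilities
(`fourArm_exponent_of_altLimits`, `ArmExponentsFourArmInputs.lean`; in the two-sided-bounds form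
`hlow`/`hup` of `fourArm_exponent_of_eventualBounds_alt_crit`, `ArmExponentsFourArmAlt.lean`). The
two-arm template is `TwoArmScalingLimitFromLoops.lean` (portmanteau under the Camia–Newman loop
limit `exists_isCNLFamily_tendsto`, with the dictionary "two arms ⇔ an interface loop crosses the
annulus"). Here we carry out its **lower half for four alternating arms**, with the dictionary of
`AltFourArmOfInterfaces.lean` (three shell traversals by interface loops ⇒ `altFourArm`):

* `loopShellTraversal ρ R` — the event, on the space `LoopSpace ℂ` of loop collections, that the
  round shell `{ρ ≤ |z| ≤ R}` is crossed four times by members of the collection: one member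
  with three separate traversals in time (Aizenman–Burchard; a closed curve then crosses four
  times), or two members with different traces each meeting `{|z| ≤ ρ}` and `{|z| ≥ R}`
  (Smirnov–Werner's `j = 4` crossings read on the loop ensemble; Garban–Pete–Schramm 2013, §2.4:
  "if there are at least 4 interfaces, then also `𝒜₄` holds"). The first clause is stated with a
  representative (`CurveClass.mk γ ∈ L`, `γ.HasTraversals 3 0 ρ R`), the traversal count being
  insensitive to reparametrisation (`Curve.HasTraversals.reparam`) and stable under the curve
  distance up to the radii (`Curve.HasTraversals.of_dist_lt`); the second is a condition on traces
  only, as the two-arm event `loopHexCrossing` of `TwoArmScalingLimitFromLoops.lean`;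
* `eventually_mem_altFourArm_of_triLoopCollection` — **lattice step**: for `0 < ρ < (√3/2) r₁`,
  `r₁ ≤ r₂ < R` and a Jordan domain `D ⊇ B̄(0, r₂)`, for all large `n` every configuration whose
  loop collection `triLoopCollection D n⁻¹ ω` (Camia–Newman: the classes of the interface loops of
  the configuration restricted to the mesh points of `D`) lies in `loopShellTraversal ρ R` belongs
  to `altFourArm (n r₁) (n r₂)` (members are approximated by interface loops of the restricted
  configuration; different traces of interface loops are disjoint, `polyTrace_eq_or_disjoint`;
  the annulus sites lie in `D`, `altFourArm_determined`);
* `eventually_lt_altFourArmProbAt_of_tendstoLaw` — **portmanteau, lower half**: if the loop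
  collections converge in law to `P'` as the mesh tends to `0⁺` (as asserted for every `D` by
  `exists_isCNLFamily_tendsto`), then for every `l < P'(interior (loopShellTraversal ρ R))`,
  eventually `l < P_{1/2}(altFourArm (n r₁) (n r₂))` — i.e.
  `liminf_n π̂^alt(n r₁, n r₂) ≥ P'(interior loopShellTraversal ρ R)`, the shape of the hypothesis
  `hlow` of `fourArm_exponent_of_eventualBounds_alt_crit` with `gl` a continuum quantity;
* `loopShellTraversal_subset_interior` — the interior is not smaller than the event of a slightly
  harder shell: `loopShellTraversal (ρ - ε) (R + ε) ⊆ interior (loopShellTraversal ρ R)`.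

What this leaves for (16)₄ along the loop route (see the module docstring of
`AltFourArmOfInterfaces.lean`): the upper half (arms ⇒ loop traversals, plus an a-priori bound
excluding two distinct crossing interfaces at vanishing loop distance), and the continuum
statements about the Camia–Newman limit (the value and the exponent `5/4` of
`P'(loopShellTraversal ρ R)`: Smirnov–Werner (12)–(14), Lawler–Schramm–Werner's derivative exponent
`ν(1) = 5/4`). No named fact is introduced.

## References

* S. Smirnov, W. Werner, Math. Res. Lett. 8 (2001) 729–744, §4, Remark 6, (15), (16)
  [SmirnovWernerMRL2001].
* C. Garban, G. Pete, O. Schramm, J. Amer. Math. Soc. 26 (2013), §2.4 [GarbanPeteSchramm2013Pivotal].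
* F. Camia, C. M. Newman, Comm. Math. Phys. 268 (2006), §2, Thms 1–3 [CamiaNewman2006].
* M. Aizenman, A. Burchard, Duke Math. J. 99 (1999), §1 (1.3), §2.1 [AizenmanBurchardDuke1999].
* P. Billingsley, *Convergence of probability measures*, 2nd ed. (1999), Thm 2.1 (portmanteau)
  [Billingsley1999].

Tree: `triLoopCollection`, `siteLoopCurve`, `triLoopLaw`, `triLoopLaw_apply`,
`tendstoLaw_iff_tendsto_triLoopLaw` (`CLE6.lean`, `CLE6SubseqLimit.lean`),
`Curve.exists_dist_reparam_lt`, `Curve.infDist_range_le`, `CurveClass.dist_mk_mk`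
(`CurveSpace.lean`), `IsSiteInterfaceLoop.polyTrace_eq_or_disjoint` (`SiteInterfaceStructure.lean`),
`mem_altFourArm_of_two_crossing_traces` (`AltFourArmOfCrossingLoops.lean`),
`IsSiteInterfaceLoop.mem_altFourArm_of_hasTraversals_three` (`AltFourArmOfInterfaces.lean`), `range_siteLoopCurve`, `norm_triMeshPoint_inv_le`, `tendsto_inv_natCast_nhdsGT_zero`
(`TwoArmScalingLimitFromLoops.lean`). Mathlib: `ProbabilityMeasure.le_liminf_measure_open_of_tendsto`,
`Metric.exists_edist_lt_of_hausdorffEDist_lt`, `Metric.infDist_le_infDist_add_dist`.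
-/

noncomputable section

open Set Metric Complex Filter MeasureTheory
open Literature.Topology.PlaneTopology Literature.Probability.RandomPlanarGeometry
open scoped unitInterval Topology ENNReal

/-! ### Traversal counts: reparametrisation invariance and stability -/

namespace Literature.Probability.RandomPlanarGeometry

namespace Curve

variable {E : Type*} [PseudoMetricSpace E]

/-- A traversal of a reparametrised curve is a traversal of the curve at the reparametrised
times. [cite: AizenmanBurchardDuke1999, §1 (1.3) and §2.1] -/
theorem isTraversal_reparam_iff (γ : Curve E) (φ : I ≃o I) {x : E} {r R : ℝ} {s t : I} :
    (γ.reparam φ).IsTraversal x r R s t ↔ γ.IsTraversal x r R (φ s) (φ t) := by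
  simp only [IsTraversal, reparam_apply, OrderIso.le_iff_le]

/-- **The traversal count is a reparametrisation invariant** (from the reparametrised curve to the
curve). [cite: AizenmanBurchardDuke1999, §1 (1.3) and §2.1] -/
theorem HasTraversals.of_reparam {γ : Curve E} {φ : I ≃o I} {k : ℕ} {x : E} {r R : ℝ}
    (h : (γ.reparam φ).HasTraversals k x r R) : γ.HasTraversals k x r R := by
  obtain ⟨s, t, hst, hsep⟩ := h
  exact ⟨fun i ↦ φ (s i), fun i ↦ φ (t i), fun i ↦ (isTraversal_reparam_iff γ φ).1 (hst i),
    fun i j hij ↦ φ.strictMono (hsep hij)⟩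

/-- **The traversal count is a reparametrisation invariant** (from the curve to the reparametrised
curve). [cite: AizenmanBurchardDuke1999, §1 (1.3) and §2.1] -/
theorem HasTraversals.reparam {γ : Curve E} (φ : I ≃o I) {k : ℕ} {x : E} {r R : ℝ}
    (h : γ.HasTraversals k x r R) : (γ.reparam φ).HasTraversals k x r R := by
  have e : (γ.reparam φ).reparam φ.symm = γ := by
    rw [reparam_reparam, OrderIso.symm_trans_self, reparam_refl]
  exact HasTraversals.of_reparam (φ := φ.symm) (by rw [e]; exact h)

/-- **Stability under uniform perturbation**: a curve within sup distance `ε` of a curve with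
`k` traversals of `D(x; r, R)` has `k` traversals of `D(x; r + ε, R - ε)` (at the same times).
[cite: AizenmanBurchardDuke1999, §1 (1.3)] -/
theorem HasTraversals.of_dist_toContinuousMap_le {γ₁ γ₂ : Curve E} {ε : ℝ}
    (h : dist γ₁.toContinuousMap γ₂.toContinuousMap ≤ ε) {k : ℕ} {x : E} {r R : ℝ}
    (h₁ : γ₁.HasTraversals k x r R) : γ₂.HasTraversals k x (r + ε) (R - ε) := by
  obtain ⟨s, t, hst, hsep⟩ := h₁
  have hd : ∀ u : I, dist (γ₁ u) (γ₂ u) ≤ ε := fun u ↦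
    (ContinuousMap.dist_apply_le_dist (f := γ₁.toContinuousMap) (g := γ₂.toContinuousMap) u).trans h
  refine ⟨s, t, fun i ↦ ⟨(hst i).1, ?_⟩, hsep⟩
  rcases (hst i).2 with ⟨h1, h2⟩ | ⟨h1, h2⟩
  · left
    constructor
    · linarith [dist_triangle (γ₂ (s i)) (γ₁ (s i)) x, dist_comm (γ₁ (s i)) (γ₂ (s i)), hd (s i)]
    · linarith [dist_triangle (γ₁ (t i)) (γ₂ (t i)) x, hd (t i)]
  · right
    constructor
    · linarith [dist_triangle (γ₁ (s i)) (γ₂ (s i)) x, hd (s i)]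
    · linarith [dist_triangle (γ₂ (t i)) (γ₁ (t i)) x, dist_comm (γ₁ (t i)) (γ₂ (t i)), hd (t i)]

/-- **Stability under the curve distance**: a curve within reparametrisation distance `< ε` of a
curve with `k` traversals of `D(x; r, R)` has `k` traversals of `D(x; r + ε, R - ε)`.
[cite: AizenmanBurchardDuke1999, §1 (1.3) and §2.1] -/
theorem HasTraversals.of_dist_lt {γ₁ γ₂ : Curve E} {ε : ℝ} (h : dist γ₁ γ₂ < ε) {k : ℕ} {x : E}
    {r R : ℝ} (h₁ : γ₁.HasTraversals k x r R) : γ₂.HasTraversals k x (r + ε) (R - ε) := by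
  obtain ⟨φ, hφ⟩ := exists_dist_reparam_lt h
  exact (h₁.of_dist_toContinuousMap_le hφ.le).of_reparam

end Curve

end Literature.Probability.RandomPlanarGeometry

namespace Literature.Probability.Percolation

open LatticeModels

/-! ### The shell-traversal event of a loop collection -/

/-- **The shell-traversal event** `Trav(ρ, R)` of a loop collection: the round shell
`{ρ ≤ |z| ≤ R}` about the origin is crossed four times by members of the collection — some member
has a representative with three separate traversals in time (Aizenman–Burchard's separate
segments; a loop crossing an annulus twice is traversed once or twice according to its base point,
a loop traversed three times crosses four times), or two members with different traces both meet
`{|z| ≤ ρ}` and `{|z| ≥ R}` (the loop collections of `CLE6.lean` contain every interface loop once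
per base face, and two interface loops of one configuration with different traces have disjoint
traces). This is the continuum counterpart, on the loop ensemble, of the alternating four-arm event
`altFourArm` of the hexagonal annuli inside the shell (Smirnov–Werner 2001, §4: for even `j`, `j`
crossings of the exploration process ⇔ `j` alternating arms, Remark 6 and (15); here read on the
full loop ensemble as in Garban–Pete–Schramm 2013, §2.4). [cite: SmirnovWernerMRL2001, §4 Remark 6, (15), (16)] [cite: GarbanPeteSchramm2013Pivotal, §2.4] -/
def loopShellTraversal (ρ R : ℝ) : Set (LoopSpace ℂ) :=
  {L | (∃ γ : Curve ℂ, CurveClass.mk γ ∈ L ∧ γ.HasTraversals 3 0 ρ R) ∨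
    ∃ c₁ ∈ L, ∃ c₂ ∈ L, CurveClass.range c₁ ≠ CurveClass.range c₂ ∧
      ((∃ z ∈ CurveClass.range c₁, ‖z‖ ≤ ρ) ∧ ∃ z ∈ CurveClass.range c₁, R ≤ ‖z‖) ∧
      ((∃ z ∈ CurveClass.range c₂, ‖z‖ ≤ ρ) ∧ ∃ z ∈ CurveClass.range c₂, R ≤ ‖z‖)}

/-- Membership in the shell-traversal event, unfolded. [folklore] -/
theorem mem_loopShellTraversal {ρ R : ℝ} {L : LoopSpace ℂ} :
    L ∈ loopShellTraversal ρ R ↔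
      (∃ γ : Curve ℂ, CurveClass.mk γ ∈ L ∧ γ.HasTraversals 3 0 ρ R) ∨
        ∃ c₁ ∈ L, ∃ c₂ ∈ L, CurveClass.range c₁ ≠ CurveClass.range c₂ ∧
          ((∃ z ∈ CurveClass.range c₁, ‖z‖ ≤ ρ) ∧ ∃ z ∈ CurveClass.range c₁, R ≤ ‖z‖) ∧
          ((∃ z ∈ CurveClass.range c₂, ‖z‖ ≤ ρ) ∧ ∃ z ∈ CurveClass.range c₂, R ≤ ‖z‖) :=
  Iff.rfl

/-- The trace-crossing condition weakens as the shell narrows. [folklore] -/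
theorem rangeCross_mono {c : CurveClass ℂ} {ρ ρ' R R' : ℝ} (hρ : ρ' ≤ ρ) (hR : R ≤ R')
    (h : (∃ z ∈ CurveClass.range c, ‖z‖ ≤ ρ') ∧ ∃ z ∈ CurveClass.range c, R' ≤ ‖z‖) :
    (∃ z ∈ CurveClass.range c, ‖z‖ ≤ ρ) ∧ ∃ z ∈ CurveClass.range c, R ≤ ‖z‖ := by
  obtain ⟨⟨z, hz, hzρ⟩, z', hz', hz'R⟩ := h
  exact ⟨⟨z, hz, hzρ.trans hρ⟩, z', hz', hR.trans hz'R⟩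

/-- The shell-traversal events decrease as the shell widens (smaller inner radius, larger outer
radius). [folklore] -/
theorem loopShellTraversal_anti {ρ ρ' R R' : ℝ} (hρ : ρ' ≤ ρ) (hR : R ≤ R') :
    loopShellTraversal ρ' R' ⊆ loopShellTraversal ρ R := by
  rintro L (⟨γ, hγ, h⟩ | ⟨c₁, h₁, c₂, h₂, hne, hc₁, hc₂⟩)
  · exact Or.inl ⟨γ, hγ, h.mono' hρ hR⟩
  · exact Or.inr ⟨c₁, h₁, c₂, h₂, hne, rangeCross_mono hρ hR hc₁, rangeCross_mono hρ hR hc₂⟩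

/-! ### Members of a nearby collection -/

/-- A member of a collection has a nearby member in every nearby collection
(`LoopSpace.exists_mem_dist_lt`), with representatives: if `CurveClass.mk γ ∈ L` and
`edist L L' < ENNReal.ofReal η`, some `γ'` with `CurveClass.mk γ' ∈ L'` has `dist γ γ' < η`. [folklore] -/
theorem exists_mk_mem_dist_lt {L L' : LoopSpace ℂ} {η : ℝ} (h : edist L L' < ENNReal.ofReal η)
    {γ : Curve ℂ} (hγ : CurveClass.mk γ ∈ L) : ∃ γ' : Curve ℂ, CurveClass.mk γ' ∈ L' ∧ dist γ γ' < η := by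
  obtain ⟨c', hc', hlt⟩ := LoopSpace.exists_mem_dist_lt h hγ
  obtain ⟨γ', rfl⟩ := CurveClass.surjective_mk c'
  rw [CurveClass.dist_mk_mk] at hlt
  exact ⟨γ', hc', hlt⟩

/-- Traces of nearby curves are nearby: every point of the trace of `γ₁` is within any
`η > dist γ₁ γ₂` of the trace of `γ₂`. [folklore] -/
theorem Curve.infDist_range_lt_of_dist_lt {γ₁ γ₂ : Curve ℂ} {η : ℝ} (h : dist γ₁ γ₂ < η) {z : ℂ}
    (hz : z ∈ γ₁.range) : Metric.infDist z γ₂.range < η := by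
  obtain ⟨t, rfl⟩ := Curve.mem_range.1 hz
  exact (Curve.infDist_range_le γ₁ γ₂ t).trans_lt h

/-- Traces of nearby curve classes are nearby. [folklore] -/
theorem CurveClass.infDist_range_lt_of_dist_lt {c₁ c₂ : CurveClass ℂ} {η : ℝ} (h : dist c₁ c₂ < η) {z : ℂ}
    (hz : z ∈ c₁.range) : Metric.infDist z c₂.range < η := by
  obtain ⟨γ₁, rfl⟩ := CurveClass.surjective_mk c₁
  obtain ⟨γ₂, rfl⟩ := CurveClass.surjective_mk c₂
  rw [CurveClass.dist_mk_mk] at h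
  exact Curve.infDist_range_lt_of_dist_lt h hz

/-- **Different compact traces are quantitatively different**: one of them has a point at positive
distance from the other. [folklore] -/
theorem exists_infDist_pos_of_range_ne {c₁ c₂ : CurveClass ℂ} (hne : c₁.range ≠ c₂.range) :
    ∃ d > 0, (∃ z ∈ c₁.range, d ≤ Metric.infDist z c₂.range) ∨ (∃ z ∈ c₂.range, d ≤ Metric.infDist z c₁.range) := by
  by_cases hsub : c₁.range ⊆ c₂.range
  · have hsub' : ¬ c₂.range ⊆ c₁.range := fun h' ↦ hne (hsub.antisymm h')
    obtain ⟨z, hz, hz'⟩ := Set.not_subset.1 hsub'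
    exact ⟨_, (c₁.isCompact_range.isClosed.notMem_iff_infDist_pos c₁.range_nonempty).1 hz', Or.inr ⟨z, hz, le_rfl⟩⟩
  · obtain ⟨z, hz, hz'⟩ := Set.not_subset.1 hsub
    exact ⟨_, (c₂.isCompact_range.isClosed.notMem_iff_infDist_pos c₂.range_nonempty).1 hz', Or.inl ⟨z, hz, le_rfl⟩⟩

/-- **Traces close to different traces are different**: if a point of `c₁.range` is at distance
`≥ d` from `c₂.range`, and `c₁', c₂'` are within `d/3` of `c₁, c₂`, then `c₁'.range ≠ c₂'.range`.
[folklore] -/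
theorem range_ne_of_dist_lt {c₁ c₂ c₁' c₂' : CurveClass ℂ} {d : ℝ} (hd : 0 < d) {z : ℂ} (hz : z ∈ c₁.range)
    (hzfar : d ≤ Metric.infDist z c₂.range) (hd₁ : dist c₁ c₁' < d / 3) (hd₂ : dist c₂ c₂' < d / 3) :
    c₁'.range ≠ c₂'.range := by
  intro heq
  obtain ⟨z', hz', hzz'⟩ := LoopSpace.exists_mem_range_dist_lt hd₁ hz
  rw [heq] at hz'
  rw [dist_comm] at hd₂
  have h3 : Metric.infDist z' c₂.range < d / 3 := CurveClass.infDist_range_lt_of_dist_lt hd₂ hz'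
  have := Metric.infDist_le_infDist_add_dist (s := c₂.range) (x := z) (y := z')
  linarith

/-- The trace-crossing condition passes to nearby classes up to the distance. [folklore] -/
theorem rangeCross_of_dist_lt {c c' : CurveClass ℂ} {ρ R η : ℝ} (h : dist c c' < η)
    (hc : (∃ z ∈ CurveClass.range c, ‖z‖ ≤ ρ) ∧ ∃ z ∈ CurveClass.range c, R ≤ ‖z‖) :
    (∃ z ∈ CurveClass.range c', ‖z‖ ≤ ρ + η) ∧ ∃ z ∈ CurveClass.range c', R - η ≤ ‖z‖ := by
  obtain ⟨⟨z₁, hz₁, h₁⟩, z₂, hz₂, h₂⟩ := hc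
  obtain ⟨z₁', hz₁', hd₁⟩ := LoopSpace.exists_mem_range_dist_lt h hz₁
  obtain ⟨z₂', hz₂', hd₂⟩ := LoopSpace.exists_mem_range_dist_lt h hz₂
  refine ⟨⟨z₁', hz₁', ?_⟩, z₂', hz₂', ?_⟩
  · have := norm_le_norm_add_norm_sub' z₁' z₁
    rw [← dist_eq_norm, dist_comm] at this
    linarith
  · have := norm_le_norm_add_norm_sub' z₂ z₂'
    rw [← dist_eq_norm] at this
    linarith

/-- **Harder shells are traversed robustly**: a collection traversing `{ρ - ε ≤ |z| ≤ R + ε}` lies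
in the interior of the event of traversing `{ρ ≤ |z| ≤ R}` (`ε > 0`): members of an `ε`-close
(resp. `d/3`-close) collection close to the given members have the same traversal count of the
easier shell, and traces at positive distance `d` stay different. [folklore] -/
theorem loopShellTraversal_subset_interior {ρ R ε : ℝ} (hε : 0 < ε) :
    loopShellTraversal (ρ - ε) (R + ε) ⊆ interior (loopShellTraversal ρ R) := by
  intro L hL
  rw [mem_interior_iff_mem_nhds]
  rcases hL with ⟨γ, hγ, h⟩ | ⟨c₁, h₁, c₂, h₂, hne, hc₁, hc₂⟩
  · refine Filter.mem_of_superset (Metric.eball_mem_nhds L (show (0 : ℝ≥0∞) < ENNReal.ofReal ε by simpa using hε))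
      fun L' hL' ↦ ?_
    rw [Metric.mem_eball, edist_comm] at hL'
    obtain ⟨γ', hγ', hd⟩ := exists_mk_mem_dist_lt hL' hγ
    refine Or.inl ⟨γ', hγ', ?_⟩
    have := h.of_dist_lt hd
    rwa [show ρ - ε + ε = ρ by ring, show R + ε - ε = R by ring] at this
  · obtain ⟨d₀, hd₀, hfar⟩ := exists_infDist_pos_of_range_ne hne
    set d : ℝ := min ε d₀ with hd
    have hdpos : 0 < d := lt_min hε hd₀
    have hdε : d ≤ ε := min_le_left _ _
    have hdd₀ : d ≤ d₀ := min_le_right _ _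
    refine Filter.mem_of_superset (Metric.eball_mem_nhds L (show (0 : ℝ≥0∞) < ENNReal.ofReal (d / 3) by
      simpa using (by positivity : (0 : ℝ) < d / 3))) fun L' hL' ↦ ?_
    rw [Metric.mem_eball, edist_comm] at hL'
    obtain ⟨c₁', hc₁', hd₁⟩ := LoopSpace.exists_mem_dist_lt hL' h₁
    obtain ⟨c₂', hc₂', hd₂⟩ := LoopSpace.exists_mem_dist_lt hL' h₂
    refine Or.inr ⟨c₁', hc₁', c₂', hc₂', ?_, ?_, ?_⟩
    · rcases hfar with ⟨z, hz, hzfar⟩ | ⟨z, hz, hzfar⟩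
      · exact range_ne_of_dist_lt hdpos hz (hdd₀.trans hzfar) hd₁ hd₂
      · exact (range_ne_of_dist_lt hdpos hz (hdd₀.trans hzfar) hd₂ hd₁).symm
    · exact rangeCross_mono (by linarith) (by linarith) (rangeCross_of_dist_lt hd₁ hc₁)
    · exact rangeCross_mono (by linarith) (by linarith) (rangeCross_of_dist_lt hd₂ hc₂)

/-! ### The lattice step: traversing collections come from alternating arms -/

/-- **An interface walk approximating a member.** If `c` lies in the loop collection of `ω` at mesh
`δ` in `D`, then for every `η > 0` there is an interface loop `w` of the restricted configuration
`ω ∩ triMeshVertices D δ` whose class is within `η` of `c` (the collection is the closure of the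
classes of these polygons). [cite: CamiaNewman2006, §2] -/
theorem exists_isSiteInterfaceLoop_dist_siteLoopCurve_lt {D : JordanDomain} {δ : ℝ} {ω : SiteConfig (Site 2)}
    {c : CurveClass ℂ} (hc : c ∈ triLoopCollection D δ ω) {η : ℝ} (hη : 0 < η) :
    ∃ (f : HexVertex) (w : hexGraph.Walk f f), IsSiteInterfaceLoop (ω ∩ triMeshVertices D.carrier δ) w ∧
      dist c (siteLoopCurve δ w) < η := by
  have hc' : c ∈ closure {c | ∃ (f : HexVertex) (w : hexGraph.Walk f f),
      IsSiteInterfaceLoop (ω ∩ triMeshVertices D.carrier δ) w ∧ c = siteLoopCurve δ w} := hc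
  obtain ⟨c', ⟨f, w, hw, rfl⟩, hcc'⟩ := Metric.mem_closure_iff.1 hc' η hη
  exact ⟨f, w, hw, hcc'⟩

/-- The same with representatives: an interface loop whose polygon is within curve distance `η` of
`γ`, when `CurveClass.mk γ` lies in the collection. [cite: CamiaNewman2006, §2] -/
theorem exists_isSiteInterfaceLoop_dist_lt {D : JordanDomain} {δ : ℝ} {ω : SiteConfig (Site 2)} {γ : Curve ℂ}
    (hγ : CurveClass.mk γ ∈ triLoopCollection D δ ω) {η : ℝ} (hη : 0 < η) :
    ∃ (f : HexVertex) (w : hexGraph.Walk f f), IsSiteInterfaceLoop (ω ∩ triMeshVertices D.carrier δ) w ∧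
      dist γ (hexLoopCurve δ w) < η := by
  obtain ⟨f, w, hw, hd⟩ := exists_isSiteInterfaceLoop_dist_siteLoopCurve_lt hγ hη
  refine ⟨f, w, hw, ?_⟩
  rwa [siteLoopCurve, CurveClass.dist_mk_mk] at hd

/-- The trace of the polygon of an interface loop is the range of its curve. [folklore] -/
theorem range_hexLoopCurve {ω : SiteConfig (Site 2)} {f : HexVertex} {w : hexGraph.Walk f f}
    (hw : IsSiteInterfaceLoop ω w) (δ : ℝ) : (hexLoopCurve δ w).range = polyTrace δ w :=
  range_toCurve_eq_polyTrace (by have := hw.three_le_length; omega)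

/-- **The lattice step.** Let `0 < ρ < (√3/2) r₁`, `r₁ ≤ r₂`, `r₂ < R`, and let the Jordan domain
`D` contain the closed disc of radius `r₂`. Then for all large `n`, every configuration `ω` whose
loop collection at mesh `n⁻¹` in `D` lies in `loopShellTraversal ρ R` has four alternating arms
across `Λ_{n r₂} ∖ Λ_{n r₁}`: `ω ∈ altFourArm (n r₁) (n r₂)`. Proof: the members in the event are
within curve distance `n⁻¹` (or a third of the gap between the two traces) of polygons of
interface loops of the restricted configuration, which then traverse a slightly thinner shell as
often (`Curve.HasTraversals.of_dist_lt`) and, in the two-member case, have different hence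
disjoint traces (`IsSiteInterfaceLoop.polyTrace_eq_or_disjoint`); `AltFourArmOfInterfaces` / `AltFourArmOfCrossingLoops`
give the arms for the restricted configuration, which agrees with `ω` on the annulus
(`altFourArm_determined`). [cite: SmirnovWernerMRL2001, §4 Remark 6 and (15)] [cite: GarbanPeteSchramm2013Pivotal, §2.4] -/
theorem eventually_mem_altFourArm_of_triLoopCollection {r₁ r₂ : ℕ} {ρ R : ℝ} (hρ : 0 < ρ)
    (h₁ : ρ < Real.sqrt 3 / 2 * r₁) (h₁₂ : r₁ ≤ r₂) (h₂ : (r₂ : ℝ) < R)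
    (D : JordanDomain) (hD : closedBall (0 : ℂ) r₂ ⊆ D.carrier) :
    ∀ᶠ n : ℕ in atTop, ∀ ω : SiteConfig (Site 2),
      triLoopCollection D (n : ℝ)⁻¹ ω ∈ loopShellTraversal ρ R → ω ∈ altFourArm (n * r₁) (n * r₂) := by
  -- the gaps and the intermediate radii
  set g : ℝ := min (Real.sqrt 3 / 2 * r₁ - ρ) (R - r₂) with hg
  have hgpos : 0 < g := lt_min (by linarith) (by linarith)
  have hg1 : g ≤ Real.sqrt 3 / 2 * r₁ - ρ := min_le_left _ _
  have hg2 : g ≤ R - r₂ := min_le_right _ _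
  set q₁ : ℝ := ρ + g / 2 with hq₁
  set q₂ : ℝ := R - g / 2 with hq₂
  have hr₁₂ : (r₁ : ℝ) ≤ r₂ := by exact_mod_cast h₁₂
  have hs3 : Real.sqrt 3 / 2 ≤ 1 := by
    rw [div_le_one (by norm_num : (0:ℝ) < 2)]
    have := Real.sqrt_le_sqrt (show (3:ℝ) ≤ 4 by norm_num)
    rw [show (4:ℝ) = 2 ^ 2 by norm_num, Real.sqrt_sq (by norm_num)] at this
    exact this
  have hr₁0 : (0 : ℝ) ≤ r₁ := Nat.cast_nonneg _
  -- large `n`: mesh `n⁻¹ ≤ g / 80`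
  have hδev : ∀ᶠ n : ℕ in atTop, (n : ℝ)⁻¹ ≤ g / 80 ∧ 1 ≤ n := by
    have h1 : ∀ᶠ n : ℕ in atTop, (n : ℝ)⁻¹ ≤ g / 80 :=
      (tendsto_inv_natCast_nhdsGT_zero.mono_right nhdsWithin_le_nhds).eventually (ge_mem_nhds (by positivity))
    exact h1.and (eventually_ge_atTop 1)
  filter_upwards [hδev] with n ⟨hδg, hn1⟩ ω hω
  set δ : ℝ := (n : ℝ)⁻¹ with hδdef
  have hnpos : (0 : ℝ) < n := by exact_mod_cast hn1
  have hδ : 0 < δ := inv_pos.2 hnpos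
  have hδn : δ * n = 1 := inv_mul_cancel₀ hnpos.ne'
  have hδr₁ : δ * ((n * r₁ : ℕ) : ℝ) = r₁ := by push_cast; rw [← mul_assoc, hδn, one_mul]
  have hδr₂ : δ * ((n * r₂ : ℕ) : ℝ) = r₂ := by push_cast; rw [← mul_assoc, hδn, one_mul]
  -- the hypotheses of the dictionary at mesh `δ`
  have hq₁pos : 0 < q₁ := by rw [hq₁]; positivity
  have hρq : ρ + δ + 8 * δ ≤ q₁ := by rw [hq₁]; linarith
  have hgap : q₁ + 40 * δ ≤ q₂ := by rw [hq₁, hq₂]; nlinarith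
  have hqR : q₂ + 8 * δ ≤ R - δ := by rw [hq₂]; linarith
  have hrad₁ : q₁ + 9 * δ ≤ Real.sqrt 3 / 2 * (δ * ((n * r₁ : ℕ) : ℝ)) := by rw [hδr₁, hq₁]; linarith
  have hrad₂ : δ * ((n * r₂ : ℕ) : ℝ) ≤ q₂ - 9 * δ := by rw [hδr₂, hq₂]; linarith
  have hrr : n * r₁ ≤ n * r₂ := Nat.mul_le_mul_left n h₁₂
  -- the restricted configuration agrees with `ω` on the annulus
  set ω' : SiteConfig (Site 2) := ω ∩ triMeshVertices D.carrier δ with hω'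
  have hagree : ∀ v ∈ triAnnulus (n * r₁) (n * r₂), (v ∈ ω ↔ v ∈ ω') := by
    intro v hv
    rw [mem_triAnnulus] at hv
    have hvD : v ∈ triMeshVertices D.carrier δ :=
      hD (mem_closedBall_zero_iff.2 (norm_triMeshPoint_inv_le hn1 hv.2))
    exact ⟨fun h ↦ ⟨h, hvD⟩, fun h ↦ h.1⟩
  rw [altFourArm_determined hrr ω ω' hagree]
  -- the two cases of the event
  rcases hω with ⟨γ, hγ, htr⟩ | ⟨c₁, hc₁, c₂, hc₂, hne, hcr₁, hcr₂⟩
  · obtain ⟨f, w, hw, hdist⟩ := exists_isSiteInterfaceLoop_dist_lt hγ hδ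
    exact hw.mem_altFourArm_of_hasTraversals_three hδ hq₁pos (by linarith) hgap (by linarith) (htr.of_dist_lt hdist)
      hrad₁ hrad₂ hrr
  · -- a point of one trace far from the other, and approximating interface loops
    obtain ⟨d, hd, hfar⟩ := exists_infDist_pos_of_range_ne hne
    set η : ℝ := min δ (d / 3) with hη
    have hηpos : 0 < η := lt_min hδ (by positivity)
    have hηδ : η ≤ δ := min_le_left _ _
    have hηd : η ≤ d / 3 := min_le_right _ _
    obtain ⟨f₁, w₁, hw₁, hd₁⟩ := exists_isSiteInterfaceLoop_dist_siteLoopCurve_lt hc₁ hηpos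
    obtain ⟨f₂, w₂, hw₂, hd₂⟩ := exists_isSiteInterfaceLoop_dist_siteLoopCurve_lt hc₂ hηpos
    have hl₁ : 0 < w₁.length := by have := hw₁.three_le_length; omega
    have hl₂ : 0 < w₂.length := by have := hw₂.three_le_length; omega
    -- the traces differ, hence are disjoint
    have hne' : polyTrace δ w₁ ≠ polyTrace δ w₂ := by
      rw [← range_siteLoopCurve hl₁ δ, ← range_siteLoopCurve hl₂ δ]
      rcases hfar with ⟨z, hz, hzfar⟩ | ⟨z, hz, hzfar⟩
      · exact range_ne_of_dist_lt hd hz hzfar (hd₁.trans_le hηd) (hd₂.trans_le hηd)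
      · exact (range_ne_of_dist_lt hd hz hzfar (hd₂.trans_le hηd) (hd₁.trans_le hηd)).symm
    have hdis : Disjoint (polyTrace δ w₁) (polyTrace δ w₂) :=
      (hw₁.polyTrace_eq_or_disjoint hδ.ne' hw₂).resolve_left hne'
    -- the traces cross the thinner shell
    have hcr₁' := rangeCross_of_dist_lt hd₁ hcr₁
    have hcr₂' := rangeCross_of_dist_lt hd₂ hcr₂
    rw [range_siteLoopCurve hl₁ δ] at hcr₁'
    rw [range_siteLoopCurve hl₂ δ] at hcr₂'
    obtain ⟨⟨z₁, hz₁, hz₁ρ⟩, z₁', hz₁', hz₁'R⟩ := hcr₁'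
    obtain ⟨⟨z₂, hz₂, hz₂ρ⟩, z₂', hz₂', hz₂'R⟩ := hcr₂'
    exact mem_altFourArm_of_two_crossing_traces hw₁ hw₂ hδ hdis (ρ := ρ + δ) (R := R - δ) hq₁pos hρq hgap hqR
      ⟨z₁, hz₁, by linarith⟩ ⟨z₁', hz₁', by linarith⟩ ⟨z₂, hz₂, by linarith⟩ ⟨z₂', hz₂', by linarith⟩ hrad₁ hrad₂ hrr

/-! ### The portmanteau lower bound -/

/-- **The alternating four-arm probabilities are eventually bounded below by the loop scaling
limit.** Let `0 < ρ < (√3/2) r₁`, `r₁ ≤ r₂ < R`, let the Jordan domain `D` contain the closed disc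
of radius `r₂`, and let the loop collections `triLoopCollection D δ` of critical site percolation
converge in law, as the mesh `δ → 0⁺`, to a probability law `P'` on `LoopSpace ℂ` (as asserted for
every `D` by the Camia–Newman fact `exists_isCNLFamily_tendsto`). Then for every
`l < P'(interior (loopShellTraversal ρ R))`, for all large `n`,
`l < P_{1/2}(altFourArm (n r₁) (n r₂)) = π̂^alt(n r₁, n r₂)`; that is,
`liminf_n π̂^alt(n r₁, n r₂) ≥ P'(interior loopShellTraversal ρ R)` — the lower half of
Smirnov–Werner's (16) for the alternating four-arm event, by the portmanteau theorem (Mathlib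
`ProbabilityMeasure.le_liminf_measure_open_of_tendsto`) and the lattice step
`eventually_mem_altFourArm_of_triLoopCollection`. [cite: SmirnovWernerMRL2001, §4 (16)] [cite: GarbanPeteSchramm2013Pivotal, §2.4] -/
theorem eventually_lt_altFourArmProbAt_of_tendstoLaw {r₁ r₂ : ℕ} {ρ R : ℝ} (hρ : 0 < ρ)
    (h₁ : ρ < Real.sqrt 3 / 2 * r₁) (h₁₂ : r₁ ≤ r₂) (h₂ : (r₂ : ℝ) < R)
    (D : JordanDomain) (hD : closedBall (0 : ℂ) r₂ ⊆ D.carrier)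
    {P' : Measure (LoopSpace ℂ)} [IsProbabilityMeasure P']
    (hconv : TendstoLaw (Ωδ := fun _ ↦ SiteConfig (Site 2)) (fun δ ↦ triLoopCollection D δ)
      (fun _ ↦ triSitePercolation half) id P')
    {l : ℝ} (hl : l < P'.real (interior (loopShellTraversal ρ R))) :
    ∀ᶠ n : ℕ in atTop, l < altFourArmProbAt half (n * r₁) (n * r₂) := by
  set O : Set (LoopSpace ℂ) := interior (loopShellTraversal ρ R) with hO
  rcases lt_or_ge l 0 with hl0 | hl0
  · exact Eventually.of_forall fun n ↦ hl0.trans_le (altFourArmProbAt_nonneg _ _ _)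
  have hT : Tendsto (triLoopLaw D) (𝓝[>] 0) (𝓝 ⟨P', inferInstance⟩) :=
    (tendstoLaw_iff_tendsto_triLoopLaw D).1 hconv
  have h1 : ENNReal.ofReal l < P' O := (ENNReal.ofReal_lt_iff_lt_toReal hl0 (measure_ne_top _ _)).2 hl
  have hport := ProbabilityMeasure.le_liminf_measure_open_of_tendsto hT (isOpen_interior : IsOpen O)
  have h3 := Filter.eventually_lt_of_lt_liminf (h1.trans_le hport)
  have h4 := tendsto_inv_natCast_nhdsGT_zero.eventually h3
  filter_upwards [h4, eventually_mem_altFourArm_of_triLoopCollection hρ h₁ h₁₂ h₂ D hD, eventually_ge_atTop 1]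
    with n hn hdict hn1
  have hδpos : (0 : ℝ) < (n : ℝ)⁻¹ := inv_pos.2 (by exact_mod_cast hn1)
  rw [triLoopLaw_apply hδpos isOpen_interior.measurableSet] at hn
  have hsub : {ω | triLoopCollection D (n : ℝ)⁻¹ ω ∈ O} ⊆ altFourArm (n * r₁) (n * r₂) :=
    fun ω hω ↦ hdict ω (interior_subset hω)
  have h5 := hn.trans_le (measure_mono hsub)
  exact (ENNReal.ofReal_lt_iff_lt_toReal hl0 (measure_ne_top _ _)).1 h5


/-- **The hypothesis `hlow` of `fourArm_exponent_of_eventualBounds_alt_crit` from the loop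
limit.** If the loop collections converge in law in every Jordan domain (the convergence half of
`exists_isCNLFamily_tendsto`, limits `ν D`) and `Dn K ⊇ B̄(0, K)`, then along the scales `m → ∞`
the alternating four-arm probabilities `π̂^alt(4m, Km)` (`K > 4`) are eventually above every
`l < gl K := (ν (Dn K))(interior (loopShellTraversal 3 (K + 1)))` — the lower scale bound of the
portmanteau-ready reduction of `fourArm_exponent` (`ArmExponentsFourArmAlt.lean`), with `gl` now an
explicit functional of the Camia–Newman limit (inner radius `3 < (√3/2)·4`, outer radius `K + 1`).
[cite: SmirnovWernerMRL2001, §4 (16)] -/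
theorem eventually_lt_altFourArmProbAt_scales_of_loopLimit
    (ν : JordanDomain → Measure (LoopSpace ℂ)) (hν : ∀ D, IsProbabilityMeasure (ν D))
    (hconv : ∀ D : JordanDomain, TendstoLaw (Ωδ := fun _ ↦ SiteConfig (Site 2))
      (fun δ ↦ triLoopCollection D δ) (fun _ ↦ triSitePercolation half) id (ν D))
    (Dn : ℕ → JordanDomain) (hDn : ∀ K : ℕ, closedBall (0 : ℂ) K ⊆ (Dn K).carrier) :
    ∀ K : ℕ, 4 < K → ∀ l : ℝ, l < (ν (Dn K)).real (interior (loopShellTraversal 3 ((K : ℝ) + 1))) →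
      ∀ᶠ m : ℕ in atTop, l < altFourArmProbAt half (m * 4) (m * K) := by
  intro K hK l hl
  haveI := hν (Dn K)
  have h3 : (3 : ℝ) < Real.sqrt 3 / 2 * ((4 : ℕ) : ℝ) := by
    have h : (3 / 2 : ℝ) < Real.sqrt 3 := by
      rw [show (3 / 2 : ℝ) = Real.sqrt ((3 / 2) ^ 2) by rw [Real.sqrt_sq (by norm_num)]]
      exact Real.sqrt_lt_sqrt (by norm_num) (by norm_num)
    push_cast
    linarith
  exact eventually_lt_altFourArmProbAt_of_tendstoLaw (r₁ := 4) (r₂ := K) (by norm_num) h3 hK.le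
    (by linarith) (Dn K) (hDn K) (hconv (Dn K)) hl

end Literature.Probability.Percolation
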